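import Literature.Probability.Percolation.CutBlocksLegCountDown
import Literature.Probability.Percolation.PortCount
import HarnessLib

/-!
# Landing edges of the tile data are landing legs

Topic `Probability/Percolation`.  Support file (proofs, no named fact) for the named fact
`SchrammSmirnov2011_thm_1_7` (the landing count of the proof of Prop. 4.1, Ann. Probab. 39 (2011),
§4): at terminality, a LANDING EDGE of the tile data of nice zones (`TileData.landings`: an
accessible fresh edge with a hub endpoint and a wet face) is a tube leg `{y, y ± eᵢ}` with collar
endpoint `y ∈ K ∩ 𝒪` — an unexamined collar edge with a hub endpoint and a wet face would be
eligible — so its collar endpoint is one of the landing legs `legsUp/Down/Right/Left` of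
`CutBlocksLegCount*.lean`, according to the direction of the tube endpoint
(`mem_legs_of_mem_landings`), and the landing edges number at most the sum of the four leg counts
(`card_landings_le_legs`).

## References

* O. Schramm, S. Smirnov, *On the scaling limits of planar percolation*, Ann. Probab. 39 (2011)
  1768–1814, arXiv:1101.5820, §4, proof of Prop. 4.1. [SchrammSmirnov2011]
-/

noncomputable section

open Set Finset Relation
open Literature.Probability.LatticeModels
open scoped Classical

namespace Literature.Probability.Percolation

namespace CutBlocks

open Seeded Seeded.Zones

variable {𝒵 : Seeded.Zones} {ω : BondConfig (Site 2)}

/-- **A landing edge is a tube leg with collar hub endpoint**: at terminality, for a landing edge `a`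
there are `y ∈ K ∩ 𝒪` and `k` with `a = {y, y + cornerUnit k}`, `y + cornerUnit k ∈ N`, and a wet
face. [cite: SchrammSmirnov2011, §4, proof of Prop. 4.1] -/
theorem exists_leg_of_mem_landings (hT : Seeded.IsTerminal 𝒵.seeds (Seeded.examined 𝒵.seeds ω) ω) (hN : 𝒵.Nice)
    {a : Sym2 (Site 2)} (ha : a ∈ (𝒵.tileData hT hN).landings) :
    ∃ y k, a = s(y, y + cornerUnit k) ∧ y ∈ 𝒵.K ∧ y + cornerUnit k ∈ 𝒵.N ∧
      Seeded.OReach 𝒵.seeds (Seeded.examined 𝒵.seeds ω) ω y ∧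
      ∃ f, IsFaceOf f s(y, y + cornerUnit k) ∧ Seeded.DReach 𝒵.seeds (Seeded.examined 𝒵.seeds ω) ω f := by
  rw [CellComplex.TileData.landings, Finset.mem_filter] at ha
  obtain ⟨hacc, ⟨y, hya, hyO⟩, f, hf, hfD⟩ := ha
  change Seeded.OReach 𝒵.seeds (Seeded.examined 𝒵.seeds ω) ω y at hyO
  change Seeded.DReach 𝒵.seeds (Seeded.examined 𝒵.seeds ω) ω f at hfD
  have hfresh : a ∈ 𝒵.fresh (Seeded.examined 𝒵.seeds ω) := (Finset.mem_filter.1 hacc).1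
  -- the edge is a tube edge: an unexamined collar edge with these two arms would be eligible
  have htube : a ∈ 𝒵.tubeEdges := by
    rcases 𝒵.mem_fresh_iff.1 hfresh with ⟨hA, hX⟩ | h
    · exact absurd ⟨hA, hX, ⟨y, hya, hyO⟩, f, hf, hfD⟩ (hT.not_eligible a)
    · exact h
  obtain ⟨haE, ⟨n, hna, hnN⟩, -⟩ := 𝒵.mem_tubeEdges_iff.1 htube
  -- `y` is a collar or far site, hence not the tube endpoint
  have hyKF := 𝒵.mem_K_or_Far_of_oReach hT hyO
  have hyN : y ∉ 𝒵.N := by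
    rcases hyKF with h | h
    · exact fun h' => (Finset.disjoint_left.1 𝒵.disjoint_K_N) h h'
    · exact h.2.1
  have hyn : y ≠ n := fun h => hyN (h ▸ hnN)
  have hayn : a = s(y, n) := by
    induction a using Sym2.ind with
    | h p q =>
      rcases Sym2.mem_iff.1 hya with rfl | rfl <;> rcases Sym2.mem_iff.1 hna with h | h
      · exact absurd h.symm hyn
      · rw [h]
      · rw [h, Sym2.eq_swap]
      · exact absurd h.symm hyn
  subst hayn
  have hadj : (zdGraph 2).Adj y n := by simpa using haE
  obtain ⟨k, rfl⟩ := CellComplex.adj_iff_exists_cornerUnit.1 hadj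
  -- `y ∈ K`: a neighbour of a tube site outside the tube
  have hyK : y ∈ 𝒵.K := by
    rcases hyKF with h | h
    · exact h
    · exfalso
      have := hN.N_nbr _ hnN (k + 2)
      rw [add_assoc, cornerUnit_add_two, add_neg_cancel, add_zero] at this
      rcases this with h' | h' | h'
      · exact h.1 h'
      · exact hyN h'
      · exact h.2.2 h'
  exact ⟨y, k, rfl, hyK, hnN, hyO, f, hf, hfD⟩

/-- **The collar endpoint of a landing edge is a landing leg** of the corresponding direction. [folklore] -/
theorem mem_legs_of_leg {y : Site 2} {k : Fin 4} (hyK : y ∈ 𝒵.K) (hn : y + cornerUnit k ∈ 𝒵.N)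
    (hO : Seeded.OReach 𝒵.seeds (Seeded.examined 𝒵.seeds ω) ω y)
    (hf : ∃ f, IsFaceOf f s(y, y + cornerUnit k) ∧ Seeded.DReach 𝒵.seeds (Seeded.examined 𝒵.seeds ω) ω f) :
    (k = 0 ∧ y ∈ legsLeft 𝒵 ω) ∨ (k = 1 ∧ y ∈ legsDown 𝒵 ω) ∨ (k = 2 ∧ y ∈ legsRight 𝒵 ω) ∨ (k = 3 ∧ y ∈ legsUp 𝒵 ω) := by
  have e0' : cornerUnit 0 = e0 := by funext i; fin_cases i <;> simp [cornerUnit]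
  have e1' : cornerUnit 1 = e1 := by funext i; fin_cases i <;> simp [cornerUnit]
  have e2' : y + cornerUnit 2 = y - e0 := by funext i; fin_cases i <;> (simp [cornerUnit]; try omega)
  have e3' : y + cornerUnit 3 = y - e1 := by funext i; fin_cases i <;> (simp [cornerUnit]; try omega)
  fin_cases k
  · left; refine ⟨rfl, ?_⟩
    simp only [Fin.zero_eta, Fin.isValue, e0'] at hn hf
    exact Finset.mem_filter.2 ⟨hyK, hn, hO, hf⟩
  · right; left; refine ⟨rfl, ?_⟩
    simp only [Fin.mk_one, Fin.isValue, e1'] at hn hf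
    exact Finset.mem_filter.2 ⟨hyK, hn, hO, hf⟩
  · right; right; left; refine ⟨rfl, ?_⟩
    rw [show ((⟨2, by norm_num⟩ : Fin 4)) = 2 from rfl, e2'] at hn hf
    exact Finset.mem_filter.2 ⟨hyK, hn, hO, hf⟩
  · right; right; right; refine ⟨rfl, ?_⟩
    rw [show ((⟨3, by norm_num⟩ : Fin 4)) = 3 from rfl, e3'] at hn hf
    exact Finset.mem_filter.2 ⟨hyK, hn, hO, hf⟩

/-- **The landing edges number at most the landing legs.** [cite: SchrammSmirnov2011, §4, proof of Prop. 4.1] -/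
theorem card_landings_le_legs (hT : Seeded.IsTerminal 𝒵.seeds (Seeded.examined 𝒵.seeds ω) ω) (hN : 𝒵.Nice) :
    (𝒵.tileData hT hN).landings.card ≤
      (legsLeft 𝒵 ω).card + (legsDown 𝒵 ω).card + (legsRight 𝒵 ω).card + (legsUp 𝒵 ω).card := by
  -- the map `a ↦ (direction, collar endpoint)` is injective
  have hleg := fun a (ha : a ∈ (𝒵.tileData hT hN).landings) => exists_leg_of_mem_landings hT hN ha
  choose! yOf kOf hspec using hleg
  set T : Finset (Fin 4 × Site 2) :=
    ((({0} : Finset (Fin 4)) ×ˢ legsLeft 𝒵 ω) ∪ (({1} : Finset (Fin 4)) ×ˢ legsDown 𝒵 ω) ∪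
      (({2} : Finset (Fin 4)) ×ˢ legsRight 𝒵 ω) ∪ (({3} : Finset (Fin 4)) ×ˢ legsUp 𝒵 ω) : Finset (Fin 4 × Site 2)) with hT'
  have hmaps : ∀ a ∈ (𝒵.tileData hT hN).landings, (kOf a, yOf a) ∈ T := by
    intro a ha
    obtain ⟨hak, hyK, hnN, hO, hf⟩ := hspec a ha
    rcases mem_legs_of_leg hyK hnN hO hf with ⟨hk, h⟩ | ⟨hk, h⟩ | ⟨hk, h⟩ | ⟨hk, h⟩ <;>
      simp [hT', hk, h]
  have hinj : Set.InjOn (fun a => (kOf a, yOf a)) ↑(𝒵.tileData hT hN).landings := by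
    intro a ha a' ha' h
    simp only [Prod.mk.injEq] at h
    rw [(hspec a ha).1, (hspec a' ha').1, h.1, h.2]
  calc (𝒵.tileData hT hN).landings.card ≤ T.card := Finset.card_le_card_of_injOn _ hmaps hinj
    _ ≤ (legsLeft 𝒵 ω).card + (legsDown 𝒵 ω).card + (legsRight 𝒵 ω).card + (legsUp 𝒵 ω).card := by
        rw [hT']
        have c0 : (({0} : Finset (Fin 4)) ×ˢ legsLeft 𝒵 ω).card = (legsLeft 𝒵 ω).card := by simp
        have c1 : (({1} : Finset (Fin 4)) ×ˢ legsDown 𝒵 ω).card = (legsDown 𝒵 ω).card := by simp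
        have c2 : (({2} : Finset (Fin 4)) ×ˢ legsRight 𝒵 ω).card = (legsRight 𝒵 ω).card := by simp
        have c3 : (({3} : Finset (Fin 4)) ×ˢ legsUp 𝒵 ω).card = (legsUp 𝒵 ω).card := by simp
        have u1 := Finset.card_union_le ((({0} : Finset (Fin 4)) ×ˢ legsLeft 𝒵 ω) ∪ (({1} : Finset (Fin 4)) ×ˢ legsDown 𝒵 ω) ∪
          (({2} : Finset (Fin 4)) ×ˢ legsRight 𝒵 ω)) ((({3} : Finset (Fin 4)) ×ˢ legsUp 𝒵 ω))
        have u2 := Finset.card_union_le ((({0} : Finset (Fin 4)) ×ˢ legsLeft 𝒵 ω) ∪ (({1} : Finset (Fin 4)) ×ˢ legsDown 𝒵 ω))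
          ((({2} : Finset (Fin 4)) ×ˢ legsRight 𝒵 ω))
        have u3 := Finset.card_union_le ((({0} : Finset (Fin 4)) ×ˢ legsLeft 𝒵 ω)) ((({1} : Finset (Fin 4)) ×ˢ legsDown 𝒵 ω))
        omega

end CutBlocks

end Literature.Probability.Percolation

end
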